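import Mathlib
import HarnessLib
import Summits.ValiantsHypothesis.ValiantsHypothesis.Theses.MonotoneRestoration
import Literature.Computability.AlgebraicComplexity.ArithCircuit
import Literature.Computability.AlgebraicComplexity.ArithCircuitProofs
import Literature.Computability.AlgebraicComplexity.MonotoneStructure
import Literature.Computability.AlgebraicComplexity.PermanentIrreducible
import Literature.ModelTheory.FiniteModelTheory.CkEquiv
import Summits.ValiantsHypothesis.ValiantsHypothesis.Theorems.MonotoneRestorationMonotoneRestorationQPCosetCount
import Summits.ValiantsHypothesis.ValiantsHypothesis.Theorems.MonotoneRestorationMonotoneRestorationQPSymmetricLB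
import Summits.ValiantsHypothesis.ValiantsHypothesis.Theorems.MonotoneRestorationMonotoneRestorationQPSupportSymmetrisation
import Summits.ValiantsHypothesis.ValiantsHypothesis.Theorems.MonotoneRestorationMonotoneRestorationQPSparseRegime
import Summits.ValiantsHypothesis.ValiantsHypothesis.Theorems.MonotoneRestorationMonotoneRestorationQPBeta
import Literature.Computability.AlgebraicComplexity.SymmetricArithCircuit
import Literature.Computability.AlgebraicComplexity.DawarWilsenach2025Proofs
import Literature.GroupTheory.PermutationGroups.SmallIndexSubgroups
import Summits.ValiantsHypothesis.ValiantsHypothesis.Theorems.MonotoneRestorationQP.Negative.LoadBearing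
import Summits.ValiantsHypothesis.ValiantsHypothesis.Theorems.MonotoneRestorationMonotoneRestorationQPPermSupportCount

/-! TTRL-lite variant V19024 of stmt-ValiantsHypothesis-15886 -/

set_option linter.dupNamespace false

namespace Summit.ValiantsHypothesis.ValiantsHypothesis.Theorems

open Summit.ValiantsHypothesis.ValiantsHypothesis.Theses.MonotoneRestoration
open Literature.Computability.AlgebraicComplexity

/-- TTRL-lite variant V19024 (`small_case`, tightness witness on the weighted side) of
`stub_monotoneComputation_of_complexity` (`stmt-ValiantsHypothesis-15886`): over `ℝ≥0` the linear
form `2·X₀ + 3·X₁` in two variables has weighted fan-in-two complexity at most `1` — it is computed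
by the single weighted sum gate `2 • X 0 + 3 • X 1` (Bürgisser's model charges one gate for a
weighted sum `c • u + d • v`). Witness circuit given explicitly; the bound is
`ArithCircuit.complexity_le_size`. [cite: Burgisser2000, Def. 2.1] -/
theorem stub_monotoneComputation_of_complexity_var19024 :
    complexity (MvPolynomial.C (2 : NNReal) * MvPolynomial.X (0 : Fin 2) +
      MvPolynomial.C (3 : NNReal) * MvPolynomial.X (1 : Fin 2)) ≤ 1 := by
  -- the one-gate witness: gate 0 = 2 • X 0 + 3 • X 1, output = gate 0
  let P : ArithCircuit NNReal (Fin 2) :=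
    { gates := [.sum [((2 : NNReal), .var 0), ((3 : NNReal), .var 1)]]
      output := .gate 0 }
  have h2 : P.IsFanInTwo := by
    intro g hg
    simp only [P, List.mem_singleton] at hg
    subst hg
    simp [ArithCircuit.Gate.fanIn, ArithCircuit.Gate.args]
  have hc : P.Computes (MvPolynomial.C (2 : NNReal) * MvPolynomial.X (0 : Fin 2) +
      MvPolynomial.C (3 : NNReal) * MvPolynomial.X (1 : Fin 2)) := by
    simp [P, ArithCircuit.Computes, ArithCircuit.eval, ArithCircuit.gateValues,
      ArithCircuit.Gate.eval, ArithCircuit.Operand.eval, MvPolynomial.smul_eq_C_mul]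
  have hs : P.size = 1 := rfl
  exact (ArithCircuit.complexity_le_size h2 hc).trans_eq hs

end Summit.ValiantsHypothesis.ValiantsHypothesis.Theorems
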